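import Literature.Computability.Cryptography.ClassBQP
import Literature.Computability.Cryptography.QuantumCircuitDescFP
import Literature.Computability.Complexity.BranchingFn
import Literature.Computability.Complexity.FoldBricks
import Literature.Computability.Complexity.StackBricks
import HarnessLib

/-!
# The sum of two quantum search problems along the parity of the input length

Topic `Literature/Computability/Cryptography` (next to `ClassBQP.lean`: `IsQSolvable`, `IsQSolvableRel`).
Two bounded-error quantum subroutines are often needed inside ONE classical wrapper
(`isQSolvable_classicalWrap`: the wrapped family routes the pre-processed input `h x` by its LENGTH
into a copy of the given family); since a circuit family has one circuit per input length, the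
cheapest way to offer two search problems `R₀`, `R₁` to one wrapper is to serve `R₀` on inputs of
even length and `R₁` on inputs of odd length (the pre-processor pads accordingly). This is the
circuit-level form of "a quantum machine may call either of two subroutines" (Bernstein–Vazirani
1997, §8.2; Arora–Barak 2009, §6.2: one circuit per input length, printed in polynomial time). This
file PROVES it in the tree's model:

* `QCircuitFamily.paritySum F₀ F₁` — the family whose circuit on inputs of length `n` is `F₀.circ n`
  for even `n` and `F₁.circ n` for odd `n` (ancilla counts likewise);
* `kernel_paritySum_of_even/odd`, `kernelProb_paritySum_of_even/odd` — its output law is that of the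
  chosen summand; `paritySum_isOracleFree`;
* `descFn_paritySum`, **`paritySum_isUniform`** — its description function is
  `iteFn ([Even |z|]) F₀.descFn F₁.descFn`, in `FP` by the tree's bricks (`Brick.parityFn ∘ Brick.lenBinF`,
  `iteFn_mem_FP`), so the sum of uniform families is uniform
  (`QCircuitFamily.isUniform_iff_descFn_mem_FP`);
* **`IsQSolvable.paritySum`**, **`IsQSolvableRel.paritySum`** — if `R₀` and `R₁` are solvable in
  bounded-error quantum polynomial time (relative to `A`), so is
  `x ↦ if Even |x| then R₀ x else R₁ x`.

Everything here is proved; the one definition has a body; no named fact is introduced. (Motivation: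
the oracle language of the van Dam–Seroussi core, `VanDamSeroussiGaussSums.lean`, needs both Shor's
discrete logarithm and Shor's factoring/order finding inside one classical wrapper.)

## References

* E. Bernstein, U. Vazirani, *Quantum complexity theory*, SIAM J. Comput. 26 (1997), §8.2 (subroutine
  calls inside quantum machines) [BernsteinVazirani1997].
* S. Arora, B. Barak, *Computational Complexity: A Modern Approach*, CUP 2009, §6.2 and Remark 6.7
  (P-uniform circuit families) [AroraBarak2009].
-/

noncomputable section

namespace Literature.Computability.Cryptography

open _root_.Computability Complexity Complexity.Brick

variable {G : QGateSet}

namespace QCircuitFamily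

/-- **The parity sum of two circuit families**: `F₀`'s circuit on inputs of even length, `F₁`'s on
inputs of odd length. [cite: AroraBarak2009, §6.2 (one circuit per input length)] -/
def paritySum (F₀ F₁ : QCircuitFamily G) : QCircuitFamily G where
  ancillas n := if Even n then F₀.ancillas n else F₁.ancillas n
  circ n :=
    if h : Even n then cast (congrArg (fun m => QCircuit G (n + m)) (if_pos h).symm) (F₀.circ n)
    else cast (congrArg (fun m => QCircuit G (n + m)) (if_neg h).symm) (F₁.circ n)

variable (F₀ F₁ : QCircuitFamily G)

/-- Ancilla count at even lengths. [folklore] -/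
theorem paritySum_ancillas_of_even {n : ℕ} (h : Even n) : (paritySum F₀ F₁).ancillas n = F₀.ancillas n := by
  simp [paritySum, h]

/-- Ancilla count at odd lengths. [folklore] -/
theorem paritySum_ancillas_of_not_even {n : ℕ} (h : ¬ Even n) : (paritySum F₀ F₁).ancillas n = F₁.ancillas n := by
  simp [paritySum, h]

/-- The circuit at even lengths is `F₀`'s (up to the cast of the ancilla count). [folklore] -/
theorem paritySum_circ_heq_of_even {n : ℕ} (h : Even n) : HEq ((paritySum F₀ F₁).circ n) (F₀.circ n) := by
  unfold paritySum
  simp only [h, ↓reduceDIte]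
  exact cast_heq _ _

/-- The circuit at odd lengths is `F₁`'s. [folklore] -/
theorem paritySum_circ_heq_of_not_even {n : ℕ} (h : ¬ Even n) : HEq ((paritySum F₀ F₁).circ n) (F₁.circ n) := by
  unfold paritySum
  simp only [h, ↓reduceDIte]
  exact cast_heq _ _

variable {F₀ F₁}

/-- Families that agree at one length (same ancilla count, same circuit) have the same output law on
inputs of that length. [folklore] -/
theorem kernel_eq_of_heq {F F' : QCircuitFamily G} {n : ℕ} (ha : F.ancillas n = F'.ancillas n)
    (hc : HEq (F.circ n) (F'.circ n)) (A : Language Bool) {x : List Bool} (hx : x.length = n) :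
    F.kernel A x = F'.kernel A x := by
  subst hx
  unfold kernel
  have key : ∀ (m m' : ℕ), m = m' → ∀ (C : QCircuit G (x.length + m)) (C' : QCircuit G (x.length + m')),
      HEq C C' → (C.outputPMF A x.get).map List.ofFn = (C'.outputPMF A x.get).map List.ofFn := by
    rintro m m' rfl C C' h
    rw [heq_iff_eq] at h
    rw [h]
  exact key _ _ ha _ _ hc

/-- A cast along the ancilla count keeps oracle-freeness. [folklore] -/
theorem isOracleFree_of_heq {n m m' : ℕ} {C : QCircuit G (n + m)} {C' : QCircuit G (n + m')} (hm : m = m')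
    (h : HEq C C') (hC : C'.IsOracleFree) : C.IsOracleFree := by
  subst hm
  rw [heq_iff_eq] at h
  rw [h]; exact hC

/-- A cast along the ancilla count keeps the gate-list code. [folklore] -/
theorem encode_eq_of_heq [Encodable G.Op] {n m m' : ℕ} {C : QCircuit G (n + m)} {C' : QCircuit G (n + m')}
    (hm : m = m') (h : HEq C C') : C.encode = C'.encode := by
  subst hm
  rw [heq_iff_eq] at h
  rw [h]

/-- **Output law of the parity sum, even lengths.** [folklore] -/
theorem kernel_paritySum_of_even (A : Language Bool) {x : List Bool} (h : Even x.length) :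
    (paritySum F₀ F₁).kernel A x = F₀.kernel A x :=
  kernel_eq_of_heq (paritySum_ancillas_of_even F₀ F₁ h) (paritySum_circ_heq_of_even F₀ F₁ h) A rfl

/-- **Output law of the parity sum, odd lengths.** [folklore] -/
theorem kernel_paritySum_of_not_even (A : Language Bool) {x : List Bool} (h : ¬ Even x.length) :
    (paritySum F₀ F₁).kernel A x = F₁.kernel A x :=
  kernel_eq_of_heq (paritySum_ancillas_of_not_even F₀ F₁ h) (paritySum_circ_heq_of_not_even F₀ F₁ h) A rfl

/-- Output probabilities of the parity sum, even lengths. [folklore] -/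
theorem kernelProb_paritySum_of_even (A : Language Bool) {x : List Bool} (h : Even x.length) (E : Set (List Bool)) :
    (paritySum F₀ F₁).kernelProb A x E = F₀.kernelProb A x E := by
  unfold kernelProb; rw [kernel_paritySum_of_even A h]

/-- Output probabilities of the parity sum, odd lengths. [folklore] -/
theorem kernelProb_paritySum_of_not_even (A : Language Bool) {x : List Bool} (h : ¬ Even x.length) (E : Set (List Bool)) :
    (paritySum F₀ F₁).kernelProb A x E = F₁.kernelProb A x E := by
  unfold kernelProb; rw [kernel_paritySum_of_not_even A h]

/-- The parity sum of oracle-free families is oracle-free. [folklore] -/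
theorem paritySum_isOracleFree (h₀ : F₀.IsOracleFree) (h₁ : F₁.IsOracleFree) : (paritySum F₀ F₁).IsOracleFree := by
  intro n
  by_cases h : Even n
  · exact isOracleFree_of_heq (paritySum_ancillas_of_even F₀ F₁ h) (paritySum_circ_heq_of_even F₀ F₁ h) (h₀ n)
  · exact isOracleFree_of_heq (paritySum_ancillas_of_not_even F₀ F₁ h) (paritySum_circ_heq_of_not_even F₀ F₁ h) (h₁ n)

variable [Encodable G.Op]

/-- Families that agree at one length have the same description on inputs of that length.
[folklore] -/
theorem descFn_eq_of_heq {F F' : QCircuitFamily G} {n : ℕ} (ha : F.ancillas n = F'.ancillas n)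
    (hc : HEq (F.circ n) (F'.circ n)) {z : List Bool} (hz : z.length = n) : F.descFn z = F'.descFn z := by
  subst hz
  unfold descFn
  have key : ∀ (m m' : ℕ), m = m' → ∀ (C : QCircuit G (z.length + m)) (C' : QCircuit G (z.length + m')),
      HEq C C' → QCircuit.sigmaEncode (G := G) ⟨z.length, m, C⟩ = QCircuit.sigmaEncode (G := G) ⟨z.length, m', C'⟩ := by
    rintro m m' rfl C C' h
    rw [heq_iff_eq] at h
    rw [h]
  exact key _ _ ha _ _ hc

/-- **The description function of the parity sum** branches on the parity of the length.
[cite: AroraBarak2009, §6.2] -/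
theorem descFn_paritySum (z : List Bool) :
    (paritySum F₀ F₁).descFn z = if Even z.length then F₀.descFn z else F₁.descFn z := by
  by_cases h : Even z.length
  · rw [if_pos h]
    exact descFn_eq_of_heq (paritySum_ancillas_of_even F₀ F₁ h) (paritySum_circ_heq_of_even F₀ F₁ h) rfl
  · rw [if_neg h]
    exact descFn_eq_of_heq (paritySum_ancillas_of_not_even F₀ F₁ h) (paritySum_circ_heq_of_not_even F₀ F₁ h) rfl

/-- The condition "the length is even" as a one-bit `FP` string function. [folklore] -/
theorem parityFn_lenBinF_apply (z : List Bool) : (parityFn ∘ lenBinF) z = [decide (Even z.length)] := by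
  rw [Function.comp_apply, lenBinF_apply, parityFn, bitsToNat_encodeNat]

/-- **The description function of the parity sum is an `iteFn`.** [folklore] -/
theorem descFn_paritySum_eq_iteFn :
    (paritySum F₀ F₁).descFn = iteFn (parityFn ∘ lenBinF) F₀.descFn F₁.descFn := by
  funext z
  rw [iteFn_apply (parityFn_lenBinF_apply z), descFn_paritySum]
  by_cases h : Even z.length
  · rw [if_pos h, decide_eq_true h, if_pos rfl]
  · rw [if_neg h, decide_eq_false h]; rfl

/-- **The parity sum of uniform families is uniform**: its description function is in `FP`.
[cite: AroraBarak2009, §6.2 and Remark 6.7 (P-uniformity = the description is printed in polynomial time)] -/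
theorem paritySum_isUniform (h₀ : F₀.IsUniform) (h₁ : F₁.IsUniform) : (paritySum F₀ F₁).IsUniform := by
  rw [isUniform_iff_descFn_mem_FP] at h₀ h₁ ⊢
  rw [descFn_paritySum_eq_iteFn]
  exact iteFn_mem_FP (comp_mem_FP parityFn_mem_FP lenBinF_mem_FP) h₀ h₁

end QCircuitFamily

/-! ### The search-problem statements -/

/-- **Bounded-error quantum search solvability is closed under parity sums**: if `R₀` and `R₁` are
`IsQSolvable`, so is `x ↦ if Even |x| then R₀ x else R₁ x`. [cite: BernsteinVazirani1997, §8.2 (subroutine calls inside quantum machines)] -/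
theorem IsQSolvable.paritySum {R₀ R₁ : List Bool → Set (List Bool)} (h₀ : IsQSolvable R₀) (h₁ : IsQSolvable R₁) :
    IsQSolvable fun x => if Even x.length then R₀ x else R₁ x := by
  obtain ⟨F₀, hF₀, hU₀, hR₀⟩ := h₀
  obtain ⟨F₁, hF₁, hU₁, hR₁⟩ := h₁
  refine ⟨QCircuitFamily.paritySum F₀ F₁, QCircuitFamily.paritySum_isOracleFree hF₀ hF₁,
    QCircuitFamily.paritySum_isUniform hU₀ hU₁, fun x => ?_⟩
  dsimp only
  by_cases h : Even x.length
  · rw [if_pos h, QCircuitFamily.kernelProb_paritySum_of_even 0 h]; exact hR₀ x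
  · rw [if_neg h, QCircuitFamily.kernelProb_paritySum_of_not_even 0 h]; exact hR₁ x

/-- The relativized form: `IsQSolvableRel A` is closed under parity sums. [cite: BernsteinVazirani1997, §8.2–8.3] -/
theorem IsQSolvableRel.paritySum {A : Language Bool} {R₀ R₁ : List Bool → Set (List Bool)}
    (h₀ : IsQSolvableRel A R₀) (h₁ : IsQSolvableRel A R₁) :
    IsQSolvableRel A fun x => if Even x.length then R₀ x else R₁ x := by
  obtain ⟨F₀, hU₀, hR₀⟩ := h₀
  obtain ⟨F₁, hU₁, hR₁⟩ := h₁
  refine ⟨QCircuitFamily.paritySum F₀ F₁, QCircuitFamily.paritySum_isUniform hU₀ hU₁, fun x => ?_⟩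
  dsimp only
  by_cases h : Even x.length
  · rw [if_pos h, QCircuitFamily.kernelProb_paritySum_of_even A h]; exact hR₀ x
  · rw [if_neg h, QCircuitFamily.kernelProb_paritySum_of_not_even A h]; exact hR₁ x

end Literature.Computability.Cryptography

end
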